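import Literature.Algebra.Homology.EulerCharacteristicShortExact
import HarnessLib

/-!
# Additivity of Mathlib's `homologyEulerChar` in a short exact sequence of complexes (via the homology sequence)

Layer `Literature/Algebra/Homology` (pure linear algebra over Mathlib; proved theorems only, 0 definitions, 0 named
facts, no instances, no notation). FILE 2 of 2 (FILE 1 = `EulerCharacteristicShortExact`). For a short exact sequence
`0 → X₁ → X₂ → X₃ → 0` of homological complexes of vector spaces over a division ring `K`
(`S : ShortComplex (HomologicalComplex (ModuleCat K) c)`, `S.ShortExact`), of ANY shape `c` with `EulerCharSigns`:

* ranks along Mathlib's homology sequence (`ShortExact.homology_exact₁∕₂∕₃`, `ShortExact.δ`,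
  `mono∕epi_homologyMap_of_…_not_rel` at the ends of the shape): `finrank_homology_X₂_eq`
  (`dim Hⁱ(X₂) = rk Hⁱ(g) + rk Hⁱ(f)`), `moduleFinite_homology_X₂`, `finrank_homology_X₁_eq`, `finrank_range_homologyMap_g_le`,
  `finrank_ker_homologyMap_f_eq_zero` (no predecessor ⇒ `Hʲ(f)` injective), `finrank_range_homologyMap_g_eq` (no successor ⇒
  `Hⁱ(g)` surjective), **`finrank_ker_homologyMap_f_eq_of_rel`** (`dim ker Hʲ(f) = dim Hⁱ(X₃) − rk Hⁱ(g)` across `c.Rel i j` —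
  both are the rank of the connecting homomorphism `δ : Hⁱ(X₃) → Hʲ(X₁)`);
* `finrankSupport_homology_X₂_subset`;
* **`homologyEulerChar_X₂_eq_add` — `χ_H(X₂) = χ_H(X₁) + χ_H(X₃)`** for Mathlib's `HomologicalComplex.homologyEulerChar`,
  assuming ONLY that the homology of `X₁` and of `X₃` is finite-dimensional in each degree with finite `finrankSupport`
  (Görtz–Wedhorn II Remark 23.62 (2) "`χ(𝓕) = χ(𝓕') + χ(𝓕'')` … by the long exact cohomology sequence"): the connecting
  ranks cancel in pairs `i ↔ next i` by FILE 1's `finsum_χ_mul_eq_neg_of_pairing`.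

This is the shape-free, cut-off-free `finsum` form of the tree's cochain-`ℤ` `Literature.Algebra.Homology.EulerCharacteristicAdditive`
(`TopCohomology.eulerChar_eq_of_shortExact`, `Finset.range (r+1)` with `H⁻¹(X₃) = 0 = H^{r+1}(X₁)`), cited, not restated, not
re-derived. Library only (cell `pub-hodge-ring2`, count-neutral); proves nothing about any crux, route or conjecture.

## References

* U. Görtz, T. Wedhorn, *Algebraic Geometry II* (2023), Remark 23.62 (2) with Definition∕Remark 23.59. [GortzWedhorn2023]
* A. Hatcher, *Algebraic Topology* (2002), §2.2 (long exact sequences; rank bookkeeping as in the proof of Thm. 2.44). [HatcherAT2002]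
* S. Lang, *Algebra* (2002), Ch. XX §3, Thm. 3.1 ff. [Lang2002]
-/

open CategoryTheory CategoryTheory.Limits

universe v u w

namespace Literature.Algebra.Homology

namespace EulerCharShortExact

variable {K : Type u} [DivisionRing K] {ι : Type w} {c : ComplexShape ι}
  {S : ShortComplex (HomologicalComplex (ModuleCat.{v} K) c)}

/-! ### Ranks along the homology sequence -/

section homology

variable (hS : S.ShortExact)
include hS

/-- `dim Hⁱ(X₂) = rk Hⁱ(g) + rk Hⁱ(f)` (exactness of `Hⁱ(X₁) → Hⁱ(X₂) → Hⁱ(X₃)`). [cite: HatcherAT2002, §2.2] -/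
theorem finrank_homology_X₂_eq (i : ι) [Module.Finite K (S.X₂.homology i)] :
    Module.finrank K (S.X₂.homology i) =
      Module.finrank K (LinearMap.range (HomologicalComplex.homologyMap S.g i).hom) +
        Module.finrank K (LinearMap.range (HomologicalComplex.homologyMap S.f i).hom) :=
  (finrank_range_add_of_exact (hS.homology_exact₂ i)).symm

/-- `Hⁱ(X₂)` is finite-dimensional when `Hⁱ(X₁)` and `Hⁱ(X₃)` are. [cite: HatcherAT2002, §2.2] -/
theorem moduleFinite_homology_X₂ (i : ι) [Module.Finite K (S.X₁.homology i)] [Module.Finite K (S.X₃.homology i)] :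
    Module.Finite K (S.X₂.homology i) :=
  moduleFinite_X₂_of_exact (hS.homology_exact₂ i)

omit hS in
/-- `dim Hʲ(X₁) = rk Hʲ(f) + dim ker Hʲ(f)` (rank–nullity). [cite: HatcherAT2002, §2.2] -/
theorem finrank_homology_X₁_eq (j : ι) [Module.Finite K (S.X₁.homology j)] :
    Module.finrank K (S.X₁.homology j) =
      Module.finrank K (LinearMap.range (HomologicalComplex.homologyMap S.f j).hom) +
        Module.finrank K (LinearMap.ker (HomologicalComplex.homologyMap S.f j).hom) :=
  (LinearMap.finrank_range_add_finrank_ker _).symm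

omit hS in
/-- `rk Hⁱ(g) ≤ dim Hⁱ(X₃)`. [cite: HatcherAT2002, §2.2] -/
theorem finrank_range_homologyMap_g_le (i : ι) [Module.Finite K (S.X₃.homology i)] :
    Module.finrank K (LinearMap.range (HomologicalComplex.homologyMap S.g i).hom) ≤
      Module.finrank K (S.X₃.homology i) :=
  Submodule.finrank_le _

/-- At a degree `j` with no predecessor, `Hʲ(f)` is injective: `dim ker Hʲ(f) = 0`. [cite: HatcherAT2002, §2.2] -/
theorem finrank_ker_homologyMap_f_eq_zero (j : ι) (hj : ¬c.Rel (c.prev j) j) :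
    Module.finrank K (LinearMap.ker (HomologicalComplex.homologyMap S.f j).hom) = 0 := by
  haveI := hS.mono_f
  haveI : Mono (HomologicalComplex.homologyMap S.f j) :=
    HomologicalComplex.mono_homologyMap_of_mono_of_not_rel S.f j fun i hi => hj (by rwa [c.prev_eq' hi])
  rw [LinearMap.ker_eq_bot.2 ((ModuleCat.mono_iff_injective _).1 inferInstance), finrank_bot]

/-- At a degree `i` with no successor, `Hⁱ(g)` is surjective: `rk Hⁱ(g) = dim Hⁱ(X₃)`. [cite: HatcherAT2002, §2.2] -/
theorem finrank_range_homologyMap_g_eq (i : ι) (hi : ¬c.Rel i (c.next i)) :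
    Module.finrank K (LinearMap.range (HomologicalComplex.homologyMap S.g i).hom) =
      Module.finrank K (S.X₃.homology i) := by
  haveI := hS.epi_g
  haveI : Epi (HomologicalComplex.homologyMap S.g i) :=
    HomologicalComplex.epi_homologyMap_of_epi_of_not_rel S.g i fun j hj => hi (by rwa [c.next_eq' hj])
  rw [LinearMap.range_eq_top.2 ((ModuleCat.epi_iff_surjective _).1 inferInstance), finrank_top]

/-- Across a step `c.Rel i j` of the shape, **`dim ker Hʲ(f) = dim Hⁱ(X₃) − rk Hⁱ(g)`** (both equal the rank of
the connecting homomorphism `δ : Hⁱ(X₃) → Hʲ(X₁)`, by exactness at `Hⁱ(X₃)` and at `Hʲ(X₁)`). [cite: HatcherAT2002, §2.2] -/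
theorem finrank_ker_homologyMap_f_eq_of_rel (i j : ι) (hij : c.Rel i j) [Module.Finite K (S.X₁.homology j)]
    [Module.Finite K (S.X₃.homology i)] :
    Module.finrank K (LinearMap.ker (HomologicalComplex.homologyMap S.f j).hom) =
      Module.finrank K (S.X₃.homology i) -
        Module.finrank K (LinearMap.range (HomologicalComplex.homologyMap S.g i).hom) := by
  have h3 := finrank_range_add_of_exact (hS.homology_exact₃ i j hij)
  have h1 := finrank_range_add_of_exact (hS.homology_exact₁ i j hij)
  have hrn := LinearMap.finrank_range_add_finrank_ker (HomologicalComplex.homologyMap S.f j).hom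
  simp only at h3 h1
  omega

end homology

/-! ### Additivity of `homologyEulerChar` -/

/-- The homology rank support of `X₂` lies in the union of those of `X₁` and `X₃`. [cite: HatcherAT2002, §2.2] -/
theorem finrankSupport_homology_X₂_subset (hS : S.ShortExact) [∀ i, Module.Finite K (S.X₁.homology i)]
    [∀ i, Module.Finite K (S.X₃.homology i)] :
    GradedObject.finrankSupport (fun i => S.X₂.homology i) ⊆
      GradedObject.finrankSupport (fun i => S.X₁.homology i) ∪ GradedObject.finrankSupport (fun i => S.X₃.homology i) := by
  intro i hi
  haveI := moduleFinite_homology_X₂ hS i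
  simp only [GradedObject.finrankSupport, Function.mem_support, ne_eq, Set.mem_union] at hi ⊢
  have h2 := finrank_homology_X₂_eq hS i
  have hg := finrank_range_homologyMap_g_le (S := S) i
  have hf : Module.finrank K (LinearMap.range (HomologicalComplex.homologyMap S.f i).hom) ≤
      Module.finrank K (S.X₁.homology i) := LinearMap.finrank_range_le _
  omega

/-- **`χ_H(X₂) = χ_H(X₁) + χ_H(X₃)`** for Mathlib's `HomologicalComplex.homologyEulerChar` along a short exact sequence
`0 → X₁ → X₂ → X₃ → 0` of complexes of ANY shape over a division ring, assuming only that the homology of `X₁` and of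
`X₃` is finite-dimensional in every degree and non-zero in finitely many (Görtz–Wedhorn II Remark 23.62 (2):
"`χ(𝓕) = χ(𝓕') + χ(𝓕'')`", by "the long exact cohomology sequence").
[cite: GortzWedhorn2023, Remark 23.62 (2)] [cite: HatcherAT2002, §2.2] [cite: Lang2002, XX §3 Thm. 3.1] -/
theorem homologyEulerChar_X₂_eq_add [c.EulerCharSigns] (hS : S.ShortExact)
    [∀ i, Module.Finite K (S.X₁.homology i)] [∀ i, Module.Finite K (S.X₃.homology i)]
    (h₁ : (GradedObject.finrankSupport fun i => S.X₁.homology i).Finite)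
    (h₃ : (GradedObject.finrankSupport fun i => S.X₃.homology i).Finite) :
    S.X₂.homologyEulerChar = S.X₁.homologyEulerChar + S.X₃.homologyEulerChar := by
  haveI := fun i => moduleFinite_homology_X₂ hS i
  simp only [HomologicalComplex.homologyEulerChar, GradedObject.eulerChar]
  -- the four rank functions have finite support
  have hrf := hasFiniteSupport_χ_mul_of_le (c := c) (X := fun i => S.X₁.homology i) h₁
    fun i => LinearMap.finrank_range_le (HomologicalComplex.homologyMap S.f i).hom
  have hkf := hasFiniteSupport_χ_mul_of_le (c := c) (X := fun i => S.X₁.homology i) h₁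
    fun i => Submodule.finrank_le (LinearMap.ker (HomologicalComplex.homologyMap S.f i).hom)
  have hrg := hasFiniteSupport_χ_mul_of_le (c := c) (X := fun i => S.X₃.homology i) h₃
    fun i => finrank_range_homologyMap_g_le (S := S) i
  have hout := hasFiniteSupport_χ_mul_of_le (c := c) (X := fun i => S.X₃.homology i) h₃
    fun i => Nat.sub_le (Module.finrank K (S.X₃.homology i))
      (Module.finrank K (LinearMap.range (HomologicalComplex.homologyMap S.g i).hom))
  -- the connecting ranks cancel in pairs
  have pair := finsum_χ_mul_eq_neg_of_pairing (c := c)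
    (fun i => Module.finrank K (S.X₃.homology i) -
      Module.finrank K (LinearMap.range (HomologicalComplex.homologyMap S.g i).hom))
    (fun j => Module.finrank K (LinearMap.ker (HomologicalComplex.homologyMap S.f j).hom))
    (fun j hj => finrank_ker_homologyMap_f_eq_zero hS j hj)
    (fun i hi => by simp only [finrank_range_homologyMap_g_eq hS i hi, Nat.sub_self])
    (fun i j hij => finrank_ker_homologyMap_f_eq_of_rel hS i j hij)
  -- rewrite the three Euler characteristics through the four rank functions
  have e₂ : ∀ i, (c.χ i : ℤ) * (Module.finrank K (S.X₂.homology i) : ℤ) =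
      (c.χ i : ℤ) * (Module.finrank K (LinearMap.range (HomologicalComplex.homologyMap S.g i).hom) : ℤ) +
        (c.χ i : ℤ) * (Module.finrank K (LinearMap.range (HomologicalComplex.homologyMap S.f i).hom) : ℤ) := by
    intro i; rw [finrank_homology_X₂_eq hS i]; push_cast; ring
  have e₁ : ∀ i, (c.χ i : ℤ) * (Module.finrank K (S.X₁.homology i) : ℤ) =
      (c.χ i : ℤ) * (Module.finrank K (LinearMap.range (HomologicalComplex.homologyMap S.f i).hom) : ℤ) +
        (c.χ i : ℤ) * (Module.finrank K (LinearMap.ker (HomologicalComplex.homologyMap S.f i).hom) : ℤ) := by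
    intro i; rw [finrank_homology_X₁_eq (S := S) i]; push_cast; ring
  have e₃ : ∀ i, (c.χ i : ℤ) * (Module.finrank K (S.X₃.homology i) : ℤ) =
      (c.χ i : ℤ) * (Module.finrank K (LinearMap.range (HomologicalComplex.homologyMap S.g i).hom) : ℤ) +
        (c.χ i : ℤ) * ((Module.finrank K (S.X₃.homology i) -
          Module.finrank K (LinearMap.range (HomologicalComplex.homologyMap S.g i).hom) : ℕ) : ℤ) := by
    intro i
    have := finrank_range_homologyMap_g_le (S := S) i
    rw [← mul_add, ← Nat.cast_add, Nat.add_sub_cancel' this]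
  rw [finsum_congr e₂, finsum_congr e₁, finsum_congr e₃, finsum_add_distrib hrg hrf, finsum_add_distrib hrf hkf,
    finsum_add_distrib hrg hout, pair]
  ring

end EulerCharShortExact

end Literature.Algebra.Homology
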